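import Summits.AtomisticToContinuum.HydrodynamicLimit.Theorems.OneFlightGossipEngineEnergyCurrentTailsLevelCensusSplitFloorRung0Geometry
import Summits.AtomisticToContinuum.HydrodynamicLimit.Theorems.OneFlightGossipEngineEnergyCurrentTailsLevelCensusSplitFloorRung0TubeMean
import HarnessLib

/-!
# First-partner floor at rung 0 (helper H5 of `stub_firstPartnerFloorRung0`, line `quartic-schur-ledger`,
# crux `EnergyCurrentTails`, stmt-AtomisticToContinuum-9235): the band mixing mark has positive Maxwellian mean

The rung-0 certificate of the registered primitive T′ `stub_firstPartnerFloor` lower-bounds the Gibbs mean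
of the first-partner functional by the Boltzmann tube mean of the BAND MIXING MARK
`Ξ♭(ω, v, w) = 𝟙{1 < ‖v‖ ≤ 3, ‖w‖ ≤ 1} · 2‖v′‖²‖w′‖²`, `(v′, w′) = reflectVel ω (v, w)` (elastic reflection
along `ω`).  This file proves the one non-degeneracy input of the certificate (registered helper
`firstPartnerRung0_markPositive`): for every temperature `θ > 0` and drift `u`,
`0 < Θ̄ = ∫∫ Θ Ξ♭ (v, w) M_{1,u,θ}(v) M_{1,u,θ}(w)`, where `Θ Ξ v w = ∫_{S²} Ξ(ω, v, w) ((w − v)·ω)₊ dω` is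
the sphere-integrated mark (`sphereMark`).

Proof.  For `‖v − v₀‖ < 1/10` (`‖v₀‖ = 5/2`), `‖w‖ < 1/10` and a unit normal `ω` at cosine
`⟪a, ω⟫ ∈ [13/20, 3/4]` to `a = (w − v)/‖w − v‖` (the zone of the sibling file `…SplitFloorRung0Geometry`),
the outgoing pair has `‖w′‖ ≥ 1` and `‖v′‖² ≥ 1` (`bandMark_zone`), so `Ξ♭ ≥ 1` there; hence
`Θ Ξ♭ (v, w) ≥ Θ 𝟙{Ξ♭ ≥ 1} (v, w) ≥ ‖w − v‖ · c_Z ≥ 2 c_Z` by the hat-box flux of the zone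
(`sphereMark_ge_of_zone`, `zoneArea_pos`; `sphereMark_floor_of_zone`).  The two balls are Lebesgue-non-null, hence `N(u, θ)`-non-null
(positive Maxwellian density), and `Θ Ξ♭ ≥ 0` is bounded (speed cutoff), so the Maxwellian mean is at least
`2 c_Z · N(u,θ)(B(v₀, 1/10)) · N(u,θ)(B(0, 1/10)) > 0` (`integral_sphereMark_mul_maxwellian_pos`).

References: C. Cercignani, R. Illner, M. Pulvirenti (1994) §2.2 (collision cylinder); Archimedes (hat-box).
-/

noncomputable section

open scoped BigOperators Classical ENNReal InnerProductSpace
open MeasureTheory Set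
open Literature.Analysis.FluidPDE Literature.MathematicalPhysics.KineticTheory
  Literature.MathematicalPhysics.StatisticalMechanics

namespace Summit.AtomisticToContinuum.HydrodynamicLimit.Theorems

namespace QuarticSchurLedger

open EnergyCurrentTailsLevelCensus

/-! ## Positivity of a Maxwellian tube mean from a floor on a product of non-null sets -/

/-- **Positivity of the Maxwellian mean of a sphere-integrated mark.**  If the measurable mark `Ξ ≥ 0` is
bounded and vanishes at relative speed `≥ 2L`, and its sphere integral is `≥ η > 0` on a product `A × B` of
Lebesgue-non-null measurable velocity sets, then `0 < ∫∫ Θ Ξ (v, w) M_{1,u,θ}(v) M_{1,u,θ}(w)` for every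
`θ > 0`, `u` (the Maxwellian density is positive, so `A`, `B` are `N(u,θ)`-non-null). [folklore] -/
theorem integral_sphereMark_mul_maxwellian_pos {Ξ : V3 × V3 × V3 → ℝ} (hΞm : Measurable Ξ)
    (hΞ0 : ∀ p, 0 ≤ Ξ p) {C L : ℝ} (hΞC : ∀ p, |Ξ p| ≤ C) (hL : 0 ≤ L)
    (hΞL : ∀ m v v' : V3, 2 * L ≤ ‖v - v'‖ → Ξ (m, v, v') = 0) {A B : Set V3}
    (hA : MeasurableSet A) (hB : MeasurableSet B) (hA0 : volume A ≠ 0) (hB0 : volume B ≠ 0)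
    {η : ℝ} (hη : 0 < η) (hAB : ∀ v ∈ A, ∀ w ∈ B, η ≤ sphereMark Ξ v w) {θ : ℝ} (hθ : 0 < θ) (u : V3) :
    0 < ∫ p : V3 × V3, sphereMark Ξ p.1 p.2 * (localMaxwellian 1 θ u p.1 * localMaxwellian 1 θ u p.2) := by
  set γ := gaussMeasure u θ with hγ
  -- Lebesgue-non-null sets are `N(u,θ)`-non-null
  have hac : (volume : Measure V3) ≪ γ := by
    rw [hγ, ← withDensity_localMaxwellian_eq_gaussMeasure hθ u]
    exact withDensity_absolutelyContinuous'
      (continuous_localMaxwellian 1 θ u).measurable.ennreal_ofReal.aemeasurable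
      (ae_of_all _ fun v => (ENNReal.ofReal_pos.2 (localMaxwellian_pos one_pos hθ u v)).ne')
  have hγA : 0 < (γ A).toReal := ENNReal.toReal_pos (fun h => hA0 (hac h)) (measure_ne_top γ A)
  have hγB : 0 < (γ B).toReal := ENNReal.toReal_pos (fun h => hB0 (hac h)) (measure_ne_top γ B)
  -- the sphere-integrated mark is bounded and measurable, hence integrable against `γ ⊗ γ`
  have hΘm : Measurable fun p : V3 × V3 => sphereMark Ξ p.1 p.2 := measurable_sphereMark_of_measurable hΞm
  have hΘb : ∀ p : V3 × V3, ‖sphereMark Ξ p.1 p.2‖ ≤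
      C * (2 * L) * (sphereMeasure : Measure (Metric.sphere (0 : V3) 1)).real univ := fun p => by
    rw [Real.norm_eq_abs]
    exact abs_sphereMark_le_of_speedCutoff hΞC hL hΞL p.1 p.2
  have hΘi : Integrable (fun p : V3 × V3 => sphereMark Ξ p.1 p.2) (γ.prod γ) :=
    Integrable.of_bound hΘm.aestronglyMeasurable _ (ae_of_all _ hΘb)
  -- the minorant `η 𝟙_{A × B}`
  have hind : ∀ p : V3 × V3, (A ×ˢ B).indicator (fun _ => η) p ≤ sphereMark Ξ p.1 p.2 := fun p => by
    by_cases hp : p ∈ A ×ˢ B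
    · rw [Set.indicator_of_mem hp]; exact hAB p.1 hp.1 p.2 hp.2
    · rw [Set.indicator_of_notMem hp]; exact sphereMark_nonneg hΞ0 _ _
  have hind0 : ∀ p : V3 × V3, 0 ≤ (A ×ˢ B).indicator (fun _ => η) p := fun p =>
    Set.indicator_nonneg (fun _ _ => hη.le) _
  have hmono := integral_mono_of_nonneg (ae_of_all _ hind0) hΘi (ae_of_all _ hind)
  rw [integral_indicator_const _ (hA.prod hB), measureReal_def, Measure.prod_prod, ENNReal.toReal_mul,
    smul_eq_mul] at hmono
  rw [← integral_prod_gaussMeasure hθ u (fun p : V3 × V3 => sphereMark Ξ p.1 p.2)]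
  exact lt_of_lt_of_le (by positivity) hmono

/-! ## Kinematics on the mixing zone -/

/-- **The mixing zone.**  If `12/5 < ‖v‖ < 13/5`, `‖w‖ < 1/10`, `‖ω‖ = 1` and `13/20 ≤ ⟪a, ω⟫ ≤ 3/4`
(`a = ‖w − v‖⁻¹ (w − v)`), then the outgoing pair `(v′, w′) = reflectVel ω (v, w)` has `2‖v′‖²‖w′‖² ≥ 1`
(indeed `‖w′‖ ∈ [1, 17/8]`, so `‖v′‖² = ‖v‖² + ‖w‖² − ‖w′‖² ≥ 1`). [folklore] -/
theorem bandMark_zone {v w ω : V3} (hv1 : 12 / 5 < ‖v‖) (hv2 : ‖v‖ < 13 / 5) (hw : ‖w‖ < 1 / 10)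
    (hω : ‖ω‖ = 1) (ht1 : 13 / 20 ≤ ⟪‖w - v‖⁻¹ • (w - v), ω⟫_ℝ)
    (ht2 : ⟪‖w - v‖⁻¹ • (w - v), ω⟫_ℝ ≤ 3 / 4) :
    1 ≤ 2 * (‖(reflectVel ω (v, w)).1‖ ^ 2 * ‖(reflectVel ω (v, w)).2‖ ^ 2) := by
  have hc1 : (reflectVel ω (v, w)).1 = v - ⟪v - w, ω⟫_ℝ • ω := by simp [reflectVel, hω]
  have hc2 : (reflectVel ω (v, w)).2 = w + ⟪v - w, ω⟫_ℝ • ω := by simp [reflectVel, hω]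
  rw [hc1, hc2]
  have hv0 : 0 ≤ ‖v‖ := norm_nonneg v
  have hw0 : 0 ≤ ‖w‖ := norm_nonneg w
  have hd1 : 23 / 10 ≤ ‖w - v‖ := by
    have := norm_sub_norm_le v w
    rw [norm_sub_rev] at this
    linarith
  have hd2 : ‖w - v‖ ≤ 27 / 10 := by
    have := norm_sub_le w v
    linarith
  have hdpos : 0 < ‖w - v‖ := by linarith
  set t := ⟪‖w - v‖⁻¹ • (w - v), ω⟫_ℝ with htdef
  have ht0 : 0 ≤ t := by linarith
  have hct : ⟪v - w, ω⟫_ℝ = -(‖w - v‖ * t) := by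
    rw [htdef, real_inner_smul_left, ← mul_assoc, mul_inv_cancel₀ hdpos.ne', one_mul, ← inner_neg_left,
      neg_sub]
  set c := ⟪v - w, ω⟫_ℝ with hcdef
  have hcn : ‖c • ω‖ = ‖w - v‖ * t := by
    rw [norm_smul, hω, mul_one, hct, Real.norm_eq_abs, abs_neg, abs_of_nonneg (mul_nonneg hdpos.le ht0)]
  have hup : ‖w + c • ω‖ ≤ ‖w‖ + ‖w - v‖ * t := by rw [← hcn]; exact norm_add_le _ _
  have hlo : ‖w - v‖ * t - ‖w‖ ≤ ‖w + c • ω‖ := by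
    have := norm_sub_norm_le (c • ω) (-w)
    rwa [norm_neg, sub_neg_eq_add, add_comm, hcn] at this
  have hgt1 : 23 / 10 * (13 / 20) ≤ ‖w - v‖ * t := mul_le_mul hd1 ht1 (by norm_num) hdpos.le
  have hgt2 : ‖w - v‖ * t ≤ 27 / 10 * (3 / 4) := mul_le_mul hd2 ht2 ht0 (by norm_num)
  have hW1 : 1 ≤ ‖w + c • ω‖ := by linarith
  have hW2 : ‖w + c • ω‖ ≤ 17 / 8 := by linarith
  have hW1sq : 1 ≤ ‖w + c • ω‖ ^ 2 := by nlinarith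
  have hW2sq : ‖w + c • ω‖ ^ 2 ≤ (17 / 8) ^ 2 := pow_le_pow_left₀ (norm_nonneg _) hW2 2
  have hvsq : (12 / 5) ^ 2 < ‖v‖ ^ 2 := pow_lt_pow_left₀ hv1 (by norm_num) two_ne_zero
  have hV1 : 1 ≤ ‖v - c • ω‖ ^ 2 := by
    have hcons := norm_sq_post_add hω v w
    rw [← hcdef] at hcons
    nlinarith [sq_nonneg ‖w‖]
  nlinarith [mul_le_mul hV1 hW1sq zero_le_one (sq_nonneg _)]

/-! ## The floor of a sphere-integrated mark near `(v₀, 0)` -/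

/-- **Floor of the sphere-integrated mark on the mixing zone.**  If the bounded measurable mark `Ξ ≥ 0` is
`≥ 1` on the mixing zone of `bandMark_zone`, then for `‖v₀‖ = 5/2`, `‖v − v₀‖ < 1/10` and `‖w‖ < 1/10`:
`2 c_Z ≤ Θ Ξ (v, w)`, `c_Z` the (positive) area of the planar annulus of the zone
(`Θ Ξ ≥ Θ 𝟙{Ξ ≥ 1} ≥ ‖w − v‖ c_Z ≥ 2 c_Z` by `sphereMark_ge_of_zone`). [folklore] -/
theorem sphereMark_floor_of_zone {Ξ : V3 × V3 × V3 → ℝ} (hΞm : Measurable Ξ) (hΞ0 : ∀ p, 0 ≤ Ξ p)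
    {C : ℝ} (hΞC : ∀ p, Ξ p ≤ C)
    (hΞ1 : ∀ ω v w : V3, 12 / 5 < ‖v‖ → ‖v‖ < 13 / 5 → ‖w‖ < 1 / 10 → ‖ω‖ = 1 →
      13 / 20 ≤ ⟪‖w - v‖⁻¹ • (w - v), ω⟫_ℝ → ⟪‖w - v‖⁻¹ • (w - v), ω⟫_ℝ ≤ 3 / 4 → 1 ≤ Ξ (ω, v, w))
    {v₀ : V3} (hv₀ : ‖v₀‖ = 5 / 2) {v w : V3} (hv : v ∈ Metric.ball v₀ (1 / 10))
    (hw : w ∈ Metric.ball (0 : V3) (1 / 10)) :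
    2 * (volume ({p : EuclideanSpace ℝ (Fin 2) | 7 / 16 ≤ ‖p‖ ^ 2 ∧ ‖p‖ ^ 2 ≤ 231 / 400} ∩
        Metric.ball 0 1)).toReal ≤ sphereMark Ξ v w := by
  haveI := isFiniteMeasure_sphereMeasure (E := V3)
  set cZ : ℝ≥0∞ := volume ({p : EuclideanSpace ℝ (Fin 2) | 7 / 16 ≤ ‖p‖ ^ 2 ∧ ‖p‖ ^ 2 ≤ 231 / 400} ∩
    Metric.ball 0 1) with hcZ
  have hcZr : 0 < cZ.toReal := ENNReal.toReal_pos zoneArea_pos.ne' zoneArea_lt_top.ne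
  have hC0 : 0 ≤ C := (hΞ0 (0, 0, 0)).trans (hΞC _)
  rw [Metric.mem_ball, dist_eq_norm] at hv
  rw [mem_ball_zero_iff] at hw
  have hv1 : 12 / 5 < ‖v‖ := by
    have := norm_sub_norm_le v₀ v
    rw [norm_sub_rev] at this
    linarith
  have hv2 : ‖v‖ < 13 / 5 := by
    have := norm_le_norm_sub_add v v₀
    linarith
  have hd : 2 ≤ ‖w - v‖ := by
    have := norm_sub_norm_le v w
    rw [norm_sub_rev] at this
    linarith
  have hvw : 0 < ‖w - v‖ := by linarith
  -- the auxiliary indicator mark `𝟙{Ξ ≥ 1} ≤ Ξ`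
  set S : Set (V3 × V3 × V3) := {p | 1 ≤ Ξ p} with hSdef
  have hSm : MeasurableSet S := measurableSet_le measurable_const hΞm
  set Ξ₀ : V3 × V3 × V3 → ℝ := S.indicator 1 with hΞ₀def
  have hΞ₀m : Measurable Ξ₀ := measurable_one.indicator hSm
  have hΞ₀0 : ∀ p, 0 ≤ Ξ₀ p := fun p => Set.indicator_nonneg (fun _ _ => zero_le_one) _
  have hΞ₀1 : ∀ p, Ξ₀ p ≤ 1 := fun p => Set.indicator_apply_le' (fun _ => le_rfl) (fun _ => zero_le_one)
  have hΞ₀le : ∀ p, Ξ₀ p ≤ Ξ p := fun p => by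
    by_cases hp : p ∈ S
    · rw [hΞ₀def, Set.indicator_of_mem hp, Pi.one_apply]; exact hp
    · rw [hΞ₀def, Set.indicator_of_notMem hp]; exact hΞ0 p
  have hzone : ∀ ω : V3, ‖ω‖ = 1 → 13 / 20 ≤ ⟪‖w - v‖⁻¹ • (w - v), ω⟫_ℝ →
      ⟪‖w - v‖⁻¹ • (w - v), ω⟫_ℝ ≤ 3 / 4 → Ξ₀ (ω, v, w) = 1 := by
    intro ω hω h1 h2
    have hmem : ((ω, v, w) : V3 × V3 × V3) ∈ S := hΞ1 ω v w hv1 hv2 hw hω h1 h2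
    rw [hΞ₀def, Set.indicator_of_mem hmem, Pi.one_apply]
  have hz := sphereMark_ge_of_zone hΞ₀m hΞ₀0 hΞ₀1 hvw hzone
  -- monotonicity of the sphere integral in the mark
  have hF0 : ∀ ω : Metric.sphere (0 : V3) 1, 0 ≤ Ξ₀ ((ω : V3), v, w) * hardSphereKernel (w, v) ω :=
    fun ω => mul_nonneg (hΞ₀0 _) (hardSphereKernel_nonneg_le v w ω).1
  have hFle : ∀ ω : Metric.sphere (0 : V3) 1, Ξ₀ ((ω : V3), v, w) * hardSphereKernel (w, v) ω ≤
      Ξ ((ω : V3), v, w) * hardSphereKernel (w, v) ω :=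
    fun ω => mul_le_mul_of_nonneg_right (hΞ₀le _) (hardSphereKernel_nonneg_le v w ω).1
  have hFm : Measurable fun ω : Metric.sphere (0 : V3) 1 => Ξ ((ω : V3), v, w) * hardSphereKernel (w, v) ω :=
    (hΞm.comp (continuous_subtype_val.measurable.prodMk measurable_const)).mul
      (by unfold hardSphereKernel; fun_prop)
  have hFb : ∀ ω : Metric.sphere (0 : V3) 1, ‖Ξ ((ω : V3), v, w) * hardSphereKernel (w, v) ω‖ ≤ C * ‖w - v‖ :=
    fun ω => by
      obtain ⟨hk0, hk1⟩ := hardSphereKernel_nonneg_le v w ω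
      rw [Real.norm_eq_abs, abs_mul, abs_of_nonneg (hΞ0 _), abs_of_nonneg hk0]
      exact mul_le_mul (hΞC _) hk1 hk0 hC0
  have hFi : Integrable (fun ω : Metric.sphere (0 : V3) 1 => Ξ ((ω : V3), v, w) * hardSphereKernel (w, v) ω)
      (sphereMeasure : Measure (Metric.sphere (0 : V3) 1)) :=
    Integrable.of_bound hFm.aestronglyMeasurable _ (ae_of_all _ hFb)
  have hmono : sphereMark Ξ₀ v w ≤ sphereMark Ξ v w :=
    integral_mono_of_nonneg (ae_of_all _ hF0) hFi (ae_of_all _ hFle)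
  calc 2 * cZ.toReal ≤ ‖w - v‖ * cZ.toReal := mul_le_mul_of_nonneg_right hd hcZr.le
    _ ≤ sphereMark Ξ₀ v w := hz
    _ ≤ sphereMark Ξ v w := hmono

/-! ## The registered helper -/

/-- **H5 · positivity of the Maxwellian mean of the sphere-integrated band mixing mark (K₀ = K₁ = 1, K₂ = 3)**
(registered helper of the rung-0 certificate `stub_firstPartnerFloorRung0` of T′ `stub_firstPartnerFloor`,
line `quartic-schur-ledger`, stmt-AtomisticToContinuum-9235): for every `θ > 0` and drift `u`,
`0 < ∫∫ Θ Ξ♭ (v, w) M_{1,u,θ}(v) M_{1,u,θ}(w)` for the band mixing mark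
`Ξ♭(ω, v, w) = 𝟙{1 < ‖v‖ ≤ 3, ‖w‖ ≤ 1} · 2‖v′‖²‖w′‖²`, `(v′, w′) = reflectVel ω (v, w)`
(the mark is measurable, `0 ≤ Ξ♭ ≤ 50`, vanishes at relative speed `≥ 5`, and is `≥ 1` on the mixing zone). [folklore] -/
theorem firstPartnerRung0_markPositive : ∀ (θ : ℝ) (u : V3), 0 < θ → 0 < ∫ p : V3 × V3, sphereMark (fun q : V3 × V3 × V3 => if 1 < ‖q.2.1‖ ∧ ‖q.2.1‖ ≤ 3 ∧ ‖q.2.2‖ ≤ 1 then 2 * (‖(reflectVel q.1 (q.2.1, q.2.2)).1‖ ^ 2 * ‖(reflectVel q.1 (q.2.1, q.2.2)).2‖ ^ 2) else 0) p.1 p.2 * (localMaxwellian 1 θ u p.1 * localMaxwellian 1 θ u p.2) := by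
  intro θ u hθ
  set Ξ : V3 × V3 × V3 → ℝ := fun q : V3 × V3 × V3 => if 1 < ‖q.2.1‖ ∧ ‖q.2.1‖ ≤ 3 ∧ ‖q.2.2‖ ≤ 1 then
    2 * (‖(reflectVel q.1 (q.2.1, q.2.2)).1‖ ^ 2 * ‖(reflectVel q.1 (q.2.1, q.2.2)).2‖ ^ 2) else 0 with hΞdef
  -- the band mixing mark: measurable, `0 ≤ Ξ ≤ 50`, speed cutoff `5`, `≥ 1` on the mixing zone
  have hΞm : Measurable Ξ := by
    refine Measurable.ite ?_ ?_ measurable_const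
    · have h1 : Measurable fun q : V3 × V3 × V3 => ‖q.2.1‖ := by fun_prop
      have h2 : Measurable fun q : V3 × V3 × V3 => ‖q.2.2‖ := by fun_prop
      exact (measurableSet_lt measurable_const h1).inter
        ((measurableSet_le h1 measurable_const).inter (measurableSet_le h2 measurable_const))
    · simp only [reflectVel]
      fun_prop
  have hΞ0 : ∀ p, 0 ≤ Ξ p := fun p => by
    simp only [hΞdef]
    split_ifs
    · positivity
    · exact le_rfl
  have hΞC : ∀ p, Ξ p ≤ 50 := fun p => by
    simp only [hΞdef]
    split_ifs with h
    · obtain ⟨-, h2, h3⟩ := h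
      have he := norm_sq_reflectVel_fst_add_norm_sq_reflectVel_snd p.1 (p.2.1, p.2.2)
      dsimp only at he
      set x := ‖(reflectVel p.1 (p.2.1, p.2.2)).1‖ ^ 2
      set y := ‖(reflectVel p.1 (p.2.1, p.2.2)).2‖ ^ 2
      have hv : ‖p.2.1‖ ^ 2 ≤ 3 ^ 2 := pow_le_pow_left₀ (norm_nonneg _) h2 2
      have hw : ‖p.2.2‖ ^ 2 ≤ 1 ^ 2 := pow_le_pow_left₀ (norm_nonneg _) h3 2
      have hxy : x + y ≤ 10 := by rw [he]; linarith
      have hxy0 : 0 ≤ x + y := by positivity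
      nlinarith [sq_nonneg (x - y), mul_le_mul hxy hxy hxy0 (by norm_num : (0 : ℝ) ≤ 10)]
    · norm_num
  have hΞabs : ∀ p, |Ξ p| ≤ 50 := fun p => by rw [abs_of_nonneg (hΞ0 p)]; exact hΞC p
  have hΞL : ∀ m v v' : V3, 2 * (5 / 2 : ℝ) ≤ ‖v - v'‖ → Ξ (m, v, v') = 0 := fun m v v' h => by
    simp only [hΞdef]
    rw [if_neg]
    rintro ⟨-, h2, h3⟩
    have := norm_sub_le v v'
    linarith
  have hΞ1 : ∀ ω v w : V3, 12 / 5 < ‖v‖ → ‖v‖ < 13 / 5 → ‖w‖ < 1 / 10 → ‖ω‖ = 1 →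
      13 / 20 ≤ ⟪‖w - v‖⁻¹ • (w - v), ω⟫_ℝ → ⟪‖w - v‖⁻¹ • (w - v), ω⟫_ℝ ≤ 3 / 4 → 1 ≤ Ξ (ω, v, w) :=
    fun ω v w hv1 hv2 hw hω h1 h2 => by
      simp only [hΞdef]
      rw [if_pos ⟨by linarith, by linarith, by linarith⟩]
      exact bandMark_zone hv1 hv2 hw hω h1 h2
  -- the two balls and the floor
  set v₀ : V3 := PiLp.single 2 (0 : Fin 3) (5 / 2 : ℝ) with hv₀
  have hn : ‖v₀‖ = 5 / 2 := by
    rw [hv₀, PiLp.norm_single, Real.norm_eq_abs, abs_of_pos (by norm_num)]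
  have hcZ : 0 < 2 * (volume ({p : EuclideanSpace ℝ (Fin 2) | 7 / 16 ≤ ‖p‖ ^ 2 ∧ ‖p‖ ^ 2 ≤ 231 / 400} ∩
      Metric.ball 0 1)).toReal :=
    mul_pos two_pos (ENNReal.toReal_pos zoneArea_pos.ne' zoneArea_lt_top.ne)
  exact integral_sphereMark_mul_maxwellian_pos hΞm hΞ0 hΞabs (by norm_num : (0 : ℝ) ≤ 5 / 2) hΞL
    measurableSet_ball measurableSet_ball
    (Metric.measure_ball_pos volume v₀ (by norm_num : (0 : ℝ) < 1 / 10)).ne'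
    (Metric.measure_ball_pos volume (0 : V3) (by norm_num : (0 : ℝ) < 1 / 10)).ne' hcZ
    (fun v hv w hw => sphereMark_floor_of_zone hΞm hΞ0 hΞC hΞ1 hn hv hw) hθ u

end QuarticSchurLedger

end Summit.AtomisticToContinuum.HydrodynamicLimit.Theorems

end
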